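/-
Copyright (c) 2026 the pub-hodgecm-mathlib formalisation cell (harness21).  Prover seat hodgecm-mathlib-LH4-p09 (g5): Track A «(D-RAM) FOUR-FRAME» squad of crux H413, unit U2H (ii-H),
leaf (ρ2b′-X) — payer LH4-p14 (g4) socket (C) brick (C2) «H-SIDE CLOSED FORM», adapter (C2-vi): the EIGENVALUE RATIO `μ = λ∕ρλ` as the square-root witness of the descent's
discriminant class inside the third field `Fix(Θρ)`, 2026-09-04.
-/
import Literature.NumberTheory.Automorphic.UnitaryTwoDescentDiscriminantRamified   -- ★ (A-p12): `trace_eq_smul_of_descent`, `det_eq_smul_of_descent`, `disc_eq_smul_of_descent` (any fields)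
import HarnessLib

/-!
# F0 · P3c · line LH4 «(D-RAM) FOUR-FRAME» — unit (ii-H), leaf (ρ2b′-X), brick (C2-vi): THE EIGENVALUE RATIO `μ = λ∕ρλ` IS `Θρ`-FIXED AND `(μ − μ⁻¹)² = jE((t² − 4D)·t²∕D²)`,
# WITH `(t² − 4D)·t²∕D² = ι((tr²g − 4 det g)·tr²g∕det²g)` `σ`-FIXED — the `r² = ι D` input of the class selector ★ p857779 ∕ ★ p857812, in the eigen-package letters
# (Rogawski 1990 §4.9 Lemma 4.9.3; Labesse–Langlands 1979 §2; Serre, *Local Fields* XIV §4)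

Cell `pub/hodgecm-mathlib` (D-0151), crux H413 = `stmt-HodgeConjecture-24833` (helper lane `--supports stmt-HodgeConjecture-24833 --as helper`, count-neutral); THEOREMS ONLY (no
definition, no instance, no notation, no named fact, no `sorry`, default heartbeats); PURE ALGEBRA (any fields).  Tree socket served: (ρ2b′-X) `stub_U2H_fixedPointCensus_typeTwo_unit0`
(U2H ED. 15 :418) through payer LH4-p14 (g4)'s socket (C″) `hLM`, whose binders are the eigen-package letters of ★ p857432 (`jE = toPlace w w₁`, `ρ = galAdicCompletionMap c₁ hw₁`, `Θ`,
`lam`, with `lam·lam = jE t·lam − jE D`, `ρ lam = jE t − lam`, `Θ lam·lam = 1`, `Θ ∘ ρ = ρ ∘ Θ`, `D·σD = 1`, `t = D·σt`).  The [H]-half of (C″) is ★ (this seat: p857582 ∕ p857631 ∕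
p857663 ∕ p857701 ∕ p857779 ∕ p857812); its class selector (★ p857812 `false_of_{eisenstein,inert}Datum_of_ramificationIdx_{eq_one,ne_one}`) wants an element `r` of the third
field `K″ = Fix(Θρ)` (route (a): the completion of the global `Fix(cθ)`) with `r² = ι(D′)` for a `D′` in the square class of the descent's discriminant `Δ_g = tr²g − 4 det g`.  THIS
file names it WITHOUT the descent scalar: `r₀ := μ − μ⁻¹`, `μ := lam ∕ ρ lam`.
* §1 (fields `jE : E →+* M`, `ρ Θ : M →+* M`): `lam_mul_map_lam` (`lam·ρlam = jE D`), `map_map_ratio_eq` (**`Θ(ρ μ) = μ`**), `map_map_ratioWitness_eq` (**`Θ(ρ r₀) = r₀`**),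
  `ratioWitness_sq_eq` (**`r₀² = jE((t² − 4D)·t²∕D²)`**).
* §2 (a field `E` with `σ`): `map_discTraceSqDivDetSq_eq` — `D·σD = 1`, `t = D·σt` ⇒ **`σ((t² − 4D)·t²∕D²) = (t² − 4D)·t²∕D²`** (so it is `ι x`, ★ `exists_toPlace_eq_of_galAdicCompletionMap_eq`).
* §3 (the descent `diag(1, α)·U·diag(1, α)⁻¹ = s·ι(G)`, any fields): `discTraceSqDivDetSq_eq_map_of_descent` — **`(tr²U − 4det U)·tr²U∕det²U = ι((tr²G − 4det G)·tr²G∕det²G)`** (the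
  scalar `s` cancels: ★ `trace∕det∕disc_eq_smul_of_descent`), and `disc_mul_sq_eq` — `(tr²G − 4det G)·tr²G∕det²G = (u² + 4w)·(z·tr G∕det G)²` for a datum `(u² + 4w)·z² = tr²G − 4det G`:
  the SAME `(u, w)` with `z′ = z·tr G∕det G`, so ★ p857812's selector applies to ★ p857701's datum verbatim at `r := ` the pull-back of `r₀`.
HONEST LABEL: HC_CM is proved only modulo the 7 printed citations (2 remaining named inputs: hLiu418 = stmt-HodgeConjecture-24832, h413 = stmt-HodgeConjecture-24833) until rung 0
closes; (ρ2b′-X) stays OPEN; count-neutral algebra — nothing printed is asserted.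

## References
* [Rogawski1990] J. D. Rogawski, *Automorphic Representations of Unitary Groups in Three Variables*, Ann. of Math. Stud. 123 (1990), §4.9 Lemma 4.9.3 p. 56 (the elliptic torus of a
  regular element of `U(2)`, its eigenvalues and their ratio), §3.6 pp. 28–29.
* [LabesseLanglands1979] J.-P. Labesse, R. P. Langlands, *L-indistinguishability for SL(2)*, Canad. J. Math. 31 (1979), §2 pp. 7–8 (the eigenvalue ratio `γ₁∕γ₂` classifies the torus).
* [Serre1979] J.-P. Serre, *Local Fields*, GTM 67 (1979), Ch. XIV §4 (descent along a quadratic Galois extension).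
-/

set_option autoImplicit false

noncomputable section

namespace Summit.HodgeConjecture.HodgeConjecture.Cruxes.H413.F0P3cDyRamHSideDescentRatio

open Matrix Literature.NumberTheory.Automorphic Literature.NumberTheory.Automorphic.UnitaryGroup
open scoped Matrix MatrixGroups

/-! ## §1 The eigenvalue ratio `μ = λ∕ρλ` and `r₀ = μ − μ⁻¹` -/

section Model

variable {E M : Type*} [Field E] [Field M] (jE : E →+* M) (ρ Θ : M →+* M) {t D : E} {lam : M}

/-- `lam·ρlam = jE D` (from `lam² = jE t·lam − jE D`, `ρlam = jE t − lam`). [cite: Rogawski1990, §4.9 Lemma 4.9.3 p. 56] -/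
theorem lam_mul_map_lam (hlam2 : lam * lam = jE t * lam - jE D) (hρlam : ρ lam = jE t - lam) : lam * ρ lam = jE D := by
  rw [hρlam]; linear_combination (-1 : M) * hlam2

/-- **`μ = lam∕ρlam` IS `Θρ`-FIXED: `Θ(ρ μ) = μ`** (`Θlam·lam = 1`, `Θ ∘ ρ = ρ ∘ Θ`, `lam ≠ 0`, `ρlam ≠ 0`). [cite: Rogawski1990, §4.9 Lemma 4.9.3 p. 56] -/
theorem map_map_ratio_eq (hΘlam : Θ lam * lam = 1) (hΘρ : ∀ z, Θ (ρ z) = ρ (Θ z)) (hρρ : ∀ z, ρ (ρ z) = z) (hlam0 : lam ≠ 0) :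
    Θ (ρ (lam / ρ lam)) = lam / ρ lam := by
  have hΘl : Θ lam = lam⁻¹ := eq_inv_of_mul_eq_one_left hΘlam
  have hρl0 : ρ lam ≠ 0 := (map_ne_zero ρ).2 hlam0
  rw [map_div₀, map_div₀, hρρ, hΘl, hΘρ, hΘl, map_inv₀]
  field_simp

/-- **`r₀ = μ − μ⁻¹` IS `Θρ`-FIXED.** [cite: Rogawski1990, §4.9 Lemma 4.9.3 p. 56] -/
theorem map_map_ratioWitness_eq (hΘlam : Θ lam * lam = 1) (hΘρ : ∀ z, Θ (ρ z) = ρ (Θ z)) (hρρ : ∀ z, ρ (ρ z) = z) (hlam0 : lam ≠ 0) :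
    Θ (ρ (lam / ρ lam - (lam / ρ lam)⁻¹)) = lam / ρ lam - (lam / ρ lam)⁻¹ := by
  rw [map_sub, map_sub, map_inv₀, map_inv₀, map_map_ratio_eq ρ Θ hΘlam hΘρ hρρ hlam0]

/-- **`r₀² = jE((t² − 4D)·t²∕D²)`** for `r₀ = μ − μ⁻¹`, `μ = lam∕ρlam` (`(lam − ρlam)² = jE(t² − 4D)`, `lam + ρlam = jE t`, `lam·ρlam = jE D`; `D ≠ 0`, `lam ≠ 0`).
[cite: Rogawski1990, §4.9 Lemma 4.9.3 p. 56] [cite: LabesseLanglands1979, §2 p. 8] -/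
theorem ratioWitness_sq_eq (hlam2 : lam * lam = jE t * lam - jE D) (hρlam : ρ lam = jE t - lam) (hD : D ≠ 0) (hlam0 : lam ≠ 0) :
    (lam / ρ lam - (lam / ρ lam)⁻¹) ^ 2 = jE ((t ^ 2 - 4 * D) * t ^ 2 / D ^ 2) := by
  have hprod := lam_mul_map_lam jE ρ hlam2 hρlam
  have hsum : lam + ρ lam = jE t := by rw [hρlam]; ring
  have hjD : jE D ≠ 0 := (map_ne_zero jE).2 hD
  have hρl0 : ρ lam ≠ 0 := by
    intro h0; rw [h0, mul_zero] at hprod; exact hjD hprod.symm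
  have key : lam / ρ lam - (lam / ρ lam)⁻¹ = (lam - ρ lam) * (lam + ρ lam) / (lam * ρ lam) := by
    field_simp
    ring
  have hsq : (lam - ρ lam) ^ 2 = jE t ^ 2 - 4 * jE D := by
    have : (lam - ρ lam) ^ 2 = (lam + ρ lam) ^ 2 - 4 * (lam * ρ lam) := by ring
    rw [this, hsum, hprod]
  rw [key, hsum, hprod, div_pow, mul_pow, hsq, map_div₀, map_mul, map_pow, map_pow, map_sub, map_mul, map_pow, map_ofNat]

end Model

/-! ## §2 `(t² − 4D)·t²∕D²` is `σ`-fixed -/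

section Sigma

variable {E : Type*} [Field E] (σ : E →+* E) {t D : E}

/-- **`σ((t² − 4D)·t²∕D²) = (t² − 4D)·t²∕D²`** from `D·σD = 1`, `t = D·σt` (`σΔ = Δ∕D²`, `σ(t∕D) = t`). [cite: Rogawski1990, §3.6 pp. 28–29] -/
theorem map_discTraceSqDivDetSq_eq (hDσ : D * σ D = 1) (htσ : t = D * σ t) : σ ((t ^ 2 - 4 * D) * t ^ 2 / D ^ 2) = (t ^ 2 - 4 * D) * t ^ 2 / D ^ 2 := by
  have hD0 : D ≠ 0 := fun h => by rw [h, zero_mul] at hDσ; exact zero_ne_one hDσ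
  have hσD : σ D = D⁻¹ := eq_inv_of_mul_eq_one_right hDσ
  have hσt : σ t = t / D := by rw [eq_div_iff hD0, mul_comm]; exact htσ.symm
  rw [map_div₀, map_mul, map_pow, map_pow, map_sub, map_mul, map_pow, map_ofNat, hσD, hσt]
  field_simp

end Sigma

/-! ## §3 The descent: `(tr²U − 4det U)·tr²U∕det²U = ι((tr²G − 4det G)·tr²G∕det²G)` -/

section Descent

variable {F E : Type*} [Field F] [Field E] (ι : F →+* E) {α s : E} {U : Matrix (Fin 2) (Fin 2) E} {G : Matrix (Fin 2) (Fin 2) F}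

/-- **THE PROJECTIVE INVARIANT `Δ·tr²∕det²` DESCENDS WITHOUT THE SCALAR**: under `diag(1, α)·U·diag(1, α)⁻¹ = s·ι(G)` (`α ≠ 0`, `s ≠ 0`, `det G ≠ 0`),
`(tr²U − 4det U)·tr²U∕det²U = ι((tr²G − 4det G)·tr²G∕det²G)` (★ `tr U = s·ι tr G`, `det U = s²·ι det G`, `Δ_U = s²·ι Δ_G`; `s ≠ 0`). [cite: Serre1979, Ch. XIV §4] -/
theorem discTraceSqDivDetSq_eq_map_of_descent (hα0 : α ≠ 0) (hs : s ≠ 0) (hsg : Matrix.diagonal ![1, α] * U * Matrix.diagonal ![1, α⁻¹] = s • G.map ι) (hG : G.det ≠ 0) :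
    (U.trace ^ 2 - 4 * U.det) * U.trace ^ 2 / U.det ^ 2 = ι ((G.trace ^ 2 - 4 * G.det) * G.trace ^ 2 / G.det ^ 2) := by
  have hιG : ι G.det ≠ 0 := (map_ne_zero ι).2 hG
  rw [disc_eq_smul_of_descent ι hα0 hsg, trace_eq_smul_of_descent ι hα0 hsg, det_eq_smul_of_descent ι hα0 hsg]
  rw [map_div₀, map_mul, map_pow, map_pow, map_sub, map_mul, map_pow, map_ofNat]
  field_simp

/-- **SAME DATUM, RESCALED `z`**: if `(u² + 4w)·z² = tr²G − 4det G` then `(tr²G − 4det G)·tr²G∕det²G = (u² + 4w)·(z·tr G∕det G)²` (`det G ≠ 0`).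
[cite: LabesseLanglands1979, §2 p. 8] -/
theorem disc_mul_sq_eq {u w z : F} (hD : (u ^ 2 + 4 * w) * z ^ 2 = G.trace ^ 2 - 4 * G.det) (hG : G.det ≠ 0) :
    (u ^ 2 + 4 * w) * (z * G.trace / G.det) ^ 2 = (G.trace ^ 2 - 4 * G.det) * G.trace ^ 2 / G.det ^ 2 := by
  rw [← hD]; field_simp

end Descent

end Summit.HodgeConjecture.HodgeConjecture.Cruxes.H413.F0P3cDyRamHSideDescentRatio

end
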